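/-
Copyright (c) 2026. All rights reserved.
Released under Apache 2.0 license as described in the file LICENSE.
Authors: abc-iut cell, S-chain team seat abc-iut-s2-p12 (gen 7; D-0079 R-W lane U «U2-LATTICE-INTEGERS»), over
abc-iut-c312-3's `UnitLogInnerRadiusTie*` and abc-iut-w6-d060's `UnitLogBoundaryRamification*` / `UnitLogKernel`.
-/
import Literature.IUT.LogVolume.UnitLogInnerRadiusTieTorsion
import HarnessLib

/-!
# The inner radius at a TIE index `e = A·(p−1)`, IIIb: `⟹` — if `ζ_p ∈ K` and the critical ball lies in
# `log_p(𝒪_K^×)`, a TORSION WITNESS exists; hence **no witness ⇒ `r_in = A + 1`**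

Proof-only sequel (theorems, no definitions, no named fact) of `UnitLogInnerRadiusTieTorsion.lean` (§0 the
finite-field index lemma, §1 levels of `p`-th powers / roots of unity at `e = A(p−1)`, ANY `A`).  Setting as
there: `K` a proper ultrametric normed `ℚ_p`-algebra field, `p` ODD, `ϖ` a norm uniformizer,
`e = absRamificationIdx p K = A·(p−1)`, `c = ϖ^e/p`, residue polynomial `P(ā) = ā + c̄·ā^p`.

* §2 `exists_nonvalue_of_pow_prime_eq_one` — `ζ_p ∈ K` ⇒ `P` MISSES a value `b̄` (it has a non-zero zero, so is
  not one-to-one, so not onto the finite residue field); `nonvalue_natCast_mul` — non-values are stable under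
  prime-to-`p` multiples; **`exists_torsionWitness_of_closedBall_level_subset_logUnits`**: if moreover
  `{‖z‖ ≤ ‖ϖ‖^A} ⊆ log_p(𝒪_K^×)`, write `ϖ^A b = log_p u₀`, pass to a principal power `u = u₀^m` (`p ∤ m`);
  `log_p(u^p) = L(w)` with `w ∈ U^{(A+e)}` and `ζ' := u^p/w` has `log_p ζ' = 0`, so is a ROOT OF UNITY
  (abc-iut-w6-d060's `unitLog_eq_zero_iff`); `‖u^p − ζ'‖ ≤ ‖p‖·‖ϖ‖^A`; and `ζ'` is NOT a `p`-th power: were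
  `ζ' = η^p`, `v := u/η` would be a principal unit with `v^p = w ∈ U^{(A+e)}`, forcing `‖1 − v‖ ≤ ‖ϖ‖^A`
  (exactness of `p`-th powers below level `A`), and the level-`A` congruence would make `m·b` a value of `P`.
* §4a the R-W format: **no torsion witness ⇒ `r_in = A + 1`**
  (`innerRadius_tie_succ_of_forall_not_torsionWitness`: `closedBall 0 ‖ϖ‖^{A+1} ⊆ logUnits K ∧
  ¬ closedBall 0 ‖ϖ‖^A ⊆ logUnits K`; e.g. `K = ℚ_p(ζ_{p²})`, `A = p`: `r_in = p + 1`, as `K(ζ_{p³})/K` is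
  ramified).  The converse `⟸` and the `iff` are in `UnitLogInnerRadiusTieTorsionFill.lean`.

References: [cite: NeukirchANT1999, Ch. II Prop. (5.5)–(5.7)] [cite: SerreLocalFields1979, Ch. XIV §4]
[cite: Washington1997, §5.1].  Classical; `logUnits` is the cell's typing of [IUTchIV] Prop. 1.2's
`log_p(R^×)` ([claim: Mochizuki2012, status: disputed] for that locution only).  Consumer (record only): D-0079
R-W lane U column «rho_in» at tie places with `p ∣ A`.  Nothing here is disputed mathematics; no IUT statement
is asserted; nothing bears on [IUTchIII] Cor. 3.12.
-/

noncomputable section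

open Metric Set IsUltrametricDist IsLocalRing
open scoped NormedField

namespace Literature.IUT.LogVolume

open Literature.NumberTheory.GaloisRepresentations.Ultrametric BoundaryRamification

namespace LogEnvelope

section Field

variable (p : ℕ) [hp : Fact p.Prime]
variable {K : Type*} [NontriviallyNormedField K] [instK : NormedAlgebra ℚ_[p] K] [IsUltrametricDist K]
  [ProperSpace K]
variable {ϖ : Kˣ} (hϖ : IsUniformizer ϖ) {A : ℕ} (hA : absRamificationIdx p K = A * (p - 1))
include hϖ hA

/-! ### §2. `⟹`: if `ζ_p ∈ K` and the critical ball lies in `log_p(𝒪^×)`, a torsion witness exists -/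

/-- **`ζ_p ∈ K` ⇒ the residue polynomial MISSES a value**: some `b ∈ 𝒪` has `a + c·a^p ≢ b (mod 𝔪)` for
every `a ∈ 𝒪` (the polynomial has a non-zero zero, so is not one-to-one, so not onto the finite residue
field). [cite: Washington1997, §5.1] -/
theorem exists_nonvalue_of_pow_prime_eq_one (hp2 : p ≠ 2) {ζ : K} (hζ : ζ ^ p = 1) (hζ1 : ζ ≠ 1) :
    ∃ b : K, ‖b‖ ≤ 1 ∧
      ∀ a : K, ‖a‖ ≤ 1 → 1 ≤ ‖a + (ϖ : K) ^ absRamificationIdx p K / (p : K) * a ^ p - b‖ := by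
  have hc1 := norm_coeff_level_eq_one p hϖ
  let C : Valued.integer K :=
    ⟨(ϖ : K) ^ absRamificationIdx p K / (p : K), Valued.integer.mem_iff.mpr hc1.le⟩
  haveI := charP_residueField p K
  haveI : Finite (IsLocalRing.ResidueField (Valued.integer K)) := finite_residueField
  obtain ⟨a₁, ha₁, -, hΛ⟩ := exists_unit_zero_of_pow_prime_eq_one_anyLevel p hϖ hA hp2 hζ hζ1
  obtain ⟨x₁, hx₁0, hx₁⟩ := exists_ne_zero_addPoly_eq_zero_of_norm p C ha₁ hΛ
  have hnotinj : ¬ Function.Injective fun x : IsLocalRing.ResidueField (Valued.integer K) =>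
      x + residue (Valued.integer K) C * x ^ p := by
    intro hinj
    refine hx₁0 (hinj ?_)
    show x₁ + residue (Valued.integer K) C * x₁ ^ p = 0 + residue (Valued.integer K) C * 0 ^ p
    rw [hx₁, zero_pow hp.out.ne_zero, mul_zero, zero_add]
  have hnotsurj : ¬ Function.Surjective fun x : IsLocalRing.ResidueField (Valued.integer K) =>
      x + residue (Valued.integer K) C * x ^ p :=
    fun hs => hnotinj (Finite.injective_iff_surjective.mpr hs)
  by_contra hall
  push Not at hall
  exact hnotsurj (addPoly_surjective_of_norm p C hall)

omit hA in
/-- **Non-values are stable under prime-to-`p` multiples**: if `b` is missed by `a ↦ a + c·a^p (mod 𝔪)` then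
so is `m·b` for `p ∤ m` (multiply a representation of `m·b` by an inverse `n` of `m` modulo `p`, using the
`𝔽_p`-linearity `na + c(na)^p ≡ n(a + c·a^p)`). [cite: Washington1997, §5.1] -/
theorem nonvalue_natCast_mul {b : K} (hb : ‖b‖ ≤ 1)
    (hnv : ∀ a : K, ‖a‖ ≤ 1 → 1 ≤ ‖a + (ϖ : K) ^ absRamificationIdx p K / (p : K) * a ^ p - b‖)
    {m : ℕ} (hm : ¬ p ∣ m) (a : K) (ha : ‖a‖ ≤ 1) :
    1 ≤ ‖a + (ϖ : K) ^ absRamificationIdx p K / (p : K) * a ^ p - (m : K) * b‖ := by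
  have hc1 := norm_coeff_level_eq_one p hϖ
  let C : Valued.integer K :=
    ⟨(ϖ : K) ^ absRamificationIdx p K / (p : K), Valued.integer.mem_iff.mpr hc1.le⟩
  -- an inverse `n` of `m` modulo `p`: `n·m = p·t + 1`
  have hm0 : (m : ZMod p) ≠ 0 := by
    rw [Ne, CharP.cast_eq_zero_iff (ZMod p) p]; exact hm
  set n : ℕ := ((m : ZMod p)⁻¹).val with hn_def
  have hnm : ((n * m : ℕ) : ZMod p) = 1 := by
    push_cast
    rw [hn_def, ZMod.natCast_zmod_val, inv_mul_cancel₀ hm0]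
  have hnm1 : 1 ≤ n * m := by
    rcases Nat.eq_zero_or_pos (n * m) with h0 | h0
    · rw [h0, Nat.cast_zero] at hnm; exact absurd hnm zero_ne_one
    · exact h0
  have hdvd : p ∣ n * m - 1 := by
    rw [← CharP.cast_eq_zero_iff (ZMod p) p, Nat.cast_sub hnm1, hnm, Nat.cast_one, sub_self]
  obtain ⟨t, ht⟩ := hdvd
  have hnmK : ((n : K) * m) = (p : K) * t + 1 := by
    have h : n * m = p * t + 1 := by omega
    have h' := congrArg (Nat.cast : ℕ → K) h
    push_cast at h'
    exact h'
  -- norms of naturals are `≤ 1`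
  have hnat : ∀ q : ℕ, ‖(q : K)‖ ≤ 1 := fun q => by
    rw [norm_natCast_eq_padicNorm p K]; exact_mod_cast Padic.norm_int_le_one (p := p) (q : ℤ)
  by_contra hlt
  push Not at hlt
  -- `a' := n·a` would represent `b`
  have hna : ‖(n : K) * a‖ ≤ 1 := by
    rw [norm_mul]; exact mul_le_one₀ (hnat n) (norm_nonneg _) ha
  have h1 := norm_natCast_mul_addPoly_sub_lt_one p C n a ha
  have h2 : ‖(n : K) * (a + (C : K) * a ^ p) - (n : K) * ((m : K) * b)‖ < 1 := by
    rw [← mul_sub, norm_mul]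
    exact (mul_le_of_le_one_left (norm_nonneg _) (hnat n)).trans_lt hlt
  have h3 : ‖(n : K) * ((m : K) * b) - b‖ < 1 := by
    rw [← mul_assoc, hnmK, add_mul, one_mul, add_sub_cancel_right, norm_mul, norm_mul]
    calc ‖(p : K)‖ * ‖(t : K)‖ * ‖b‖ ≤ ‖(p : K)‖ * 1 * 1 := by
          gcongr
          · exact hnat t
      _ < 1 := by rw [mul_one, mul_one]; exact norm_prime_lt_one p K
  have hsum : (n : K) * a + (C : K) * ((n : K) * a) ^ p - b =
      (((n : K) * a + (C : K) * ((n : K) * a) ^ p) - (n : K) * (a + (C : K) * a ^ p)) +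
        ((n : K) * (a + (C : K) * a ^ p) - (n : K) * ((m : K) * b)) + ((n : K) * ((m : K) * b) - b) := by
    ring
  have hlt' : ‖(n : K) * a + (C : K) * ((n : K) * a) ^ p - b‖ < 1 := by
    rw [hsum]
    refine lt_of_le_of_lt (norm_add_le_max _ _) (max_lt ?_ h3)
    exact lt_of_le_of_lt (norm_add_le_max _ _) (max_lt h1 h2)
  exact (not_lt.mpr (hnv ((n : K) * a) hna)) hlt'

/-- **`⟹`.  If `ζ_p ∈ K` and `{‖z‖ ≤ ‖ϖ‖^A} ⊆ log_p(𝒪_K^×)` then there is a TORSION WITNESS: a root of unity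
`ζ' ∈ K` which is not a `p`-th power in `K`, and `u ∈ K` with `‖u^p − ζ'‖ ≤ ‖p‖·‖ϖ‖^A`** (`p` odd,
`e = A(p−1)`, ANY `A`).  [cite: SerreLocalFields1979, Ch. XIV §4] [cite: NeukirchANT1999, Ch. II (5.5)–(5.7)] -/
theorem exists_torsionWitness_of_closedBall_level_subset_logUnits (hp2 : p ≠ 2) {ζ : K} (hζ : ζ ^ p = 1)
    (hζ1 : ζ ≠ 1) (hball : closedBall (0 : K) (‖(ϖ : K)‖ ^ A) ⊆ logUnits K) :
    ∃ ζ' u : K, (∃ n : ℕ, 0 < n ∧ ζ' ^ n = 1) ∧ (∀ η : K, η ^ p ≠ ζ') ∧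
      ‖u ^ p - ζ'‖ ≤ ‖(p : K)‖ * ‖(ϖ : K)‖ ^ A := by
  have hρ0 : 0 < ‖(ϖ : K)‖ := norm_units_pos ϖ
  have hϖA0 : (ϖ : K) ^ A ≠ 0 := pow_ne_zero _ ϖ.ne_zero
  have hθ := prime_mul_pow_level_mul_rpow_lt_one p hϖ hA
  have hr1 := norm_prime_mul_pow_level_lt_one p hϖ hA
  -- a non-value `b`
  obtain ⟨b, hb, hnv⟩ := exists_nonvalue_of_pow_prime_eq_one p hϖ hA hp2 hζ hζ1
  -- `ϖ^A b = log_p u₀`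
  have hz : (ϖ : K) ^ A * b ∈ logUnits K := hball (by
    rw [mem_closedBall, dist_zero_right, norm_mul, norm_pow]
    exact mul_le_of_le_one_right (pow_nonneg hρ0.le _) hb)
  obtain ⟨u₀, hu₀, hu₀z⟩ := (mem_logUnits_iff (K := K)).mp hz
  obtain ⟨m, hm0, hmp, hmP⟩ := exists_pow_isPrincipal_not_dvd (p := p) hu₀
  set u : K := u₀ ^ m with hu_def
  have hu1 : ‖u‖ = 1 := hmP.norm_eq_one
  have hLu : unitLog u = (m : K) * ((ϖ : K) ^ A * b) := by rw [hu_def, unitLog_pow p hu₀, hu₀z]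
  have hup1 : ‖u ^ p‖ = 1 := by rw [norm_pow, hu1, one_pow]
  have hLup : unitLog (u ^ p) = (p : K) * unitLog u := unitLog_pow p hu1 p
  have hnormLup : ‖unitLog (u ^ p)‖ ≤ ‖(p : K)‖ * ‖(ϖ : K)‖ ^ A := by
    rw [hLup, hLu, norm_mul, norm_mul, norm_natCast_eq_one_of_not_dvd p hmp, one_mul, norm_mul, norm_pow]
    gcongr
    exact mul_le_of_le_one_right (pow_nonneg hρ0.le _) hb
  -- `w ∈ U^{(A+e)}` with `L(w) = log_p(u^p)`
  obtain ⟨w, hw, hLw⟩ := exists_logSeries_eq p K hθ hnormLup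
  have hwP : IsPrincipal w := by
    show ‖1 - w‖ < 1
    exact hw.trans_lt hr1
  have hw1 : ‖w‖ = 1 := hwP.norm_eq_one
  have hw0 : w ≠ 0 := norm_pos_iff.mp (by rw [hw1]; exact one_pos)
  have hwi1 : ‖w⁻¹‖ = 1 := by rw [norm_inv, hw1, inv_one]
  -- `ζ' := u^p/w` is a root of unity
  set ζ' : K := u ^ p * w⁻¹ with hζ'_def
  have hζ'1 : ‖ζ'‖ = 1 := by rw [hζ'_def, norm_mul, hup1, hwi1, mul_one]
  have hζ'0 : ζ' ≠ 0 := norm_pos_iff.mp (by rw [hζ'1]; exact one_pos)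
  have hLζ' : unitLog ζ' = 0 := by
    rw [hζ'_def, unitLog_mul p hup1 hwi1, unitLog_inv p hw1, unitLog_of_isPrincipal p hwP, hLw,
      add_neg_cancel]
  obtain ⟨N, hN0, hN⟩ := (unitLog_eq_zero_iff p K hζ'1).mp hLζ'
  have hupeq : u ^ p = ζ' * w := by rw [hζ'_def, inv_mul_cancel_right₀ hw0]
  refine ⟨ζ', u, ⟨N, hN0, hN⟩, ?_, ?_⟩
  swap
  · rw [hupeq, show ζ' * w - ζ' = ζ' * (w - 1) by ring, norm_mul, hζ'1, one_mul, norm_sub_rev]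
    exact hw
  · intro η hη
    have hη1 : ‖η‖ = 1 := by
      have h := congrArg norm hη
      rw [norm_pow, hζ'1] at h
      exact (pow_eq_one_iff_of_nonneg (norm_nonneg _) hp.out.ne_zero).mp h
    have hηi1 : ‖η⁻¹‖ = 1 := by rw [norm_inv, hη1, inv_one]
    -- `η` is torsion, so `log_p η = 0`
    have hLη : unitLog η = 0 :=
      unitLog_eq_zero_of_pow_eq_one p (Nat.mul_pos hp.out.pos hN0) (by rw [pow_mul, hη, hN])
    -- `v := u/η` is a principal unit with `v^p = w`
    set v : K := u * η⁻¹ with hv_def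
    have hv1 : ‖v‖ = 1 := by rw [hv_def, norm_mul, hu1, hηi1, mul_one]
    have hvp : v ^ p = w := by
      rw [hv_def, mul_pow, inv_pow, hη, hupeq, mul_comm ζ' w, mul_inv_cancel_right₀ hζ'0]
    have hvP : IsPrincipal v := IsPrincipal.of_pow_prime (p := p) hv1.le (by rw [hvp]; exact hwP)
    have hLv : logSeries v = (m : K) * ((ϖ : K) ^ A * b) := by
      rw [← unitLog_of_isPrincipal p hvP, hv_def, unitLog_mul p hu1 hηi1, unitLog_inv p hη1, hLη,
        neg_zero, add_zero, hLu]
    by_cases hlev : ‖(ϖ : K)‖ ^ A < ‖1 - v‖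
    · -- level below `A`: `‖1 − v^p‖ = ‖1 − v‖^p > ‖ϖ‖^{A·p} = ‖p‖·‖ϖ‖^A`
      have h := norm_one_add_pow_prime_sub_one_eq p hϖ hA (x := v - 1) (by rwa [norm_sub_rev])
        (by rw [norm_sub_rev]; exact hvP.le)
      rw [add_sub_cancel, hvp] at h
      have hlt : ‖(p : K)‖ * ‖(ϖ : K)‖ ^ A < ‖w - 1‖ := by
        rw [h, norm_sub_rev, norm_prime_mul_pow_level p hϖ hA, pow_mul]
        exact pow_lt_pow_left₀ hlev (pow_nonneg hρ0.le _) hp.out.ne_zero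
      rw [norm_sub_rev] at hlt
      exact (not_lt.mpr hw) hlt
    · -- level `≥ A`: the congruence makes `m·b` a value of the residue polynomial
      push Not at hlev
      set a : K := (v - 1) / (ϖ : K) ^ A with ha_def
      have ha : ‖a‖ ≤ 1 := by
        rw [ha_def, norm_div, norm_pow, div_le_one (pow_pos hρ0 _), norm_sub_rev]; exact hlev
      have hva : v = 1 + (ϖ : K) ^ A * a := by rw [ha_def, mul_div_cancel₀ _ hϖA0]; ring
      have hcong := norm_logSeries_sub_le_level p hϖ hA hp2 ha
      rw [← hva, hLv] at hcong
      have key : ‖a + (ϖ : K) ^ absRamificationIdx p K / (p : K) * a ^ p - (m : K) * b‖ ≤ ‖(ϖ : K)‖ := by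
        have hsplit : (m : K) * ((ϖ : K) ^ A * b) -
            (ϖ : K) ^ A * (a + (ϖ : K) ^ absRamificationIdx p K / (p : K) * a ^ p) =
            -((ϖ : K) ^ A * (a + (ϖ : K) ^ absRamificationIdx p K / (p : K) * a ^ p - (m : K) * b)) := by
          ring
        rw [hsplit, norm_neg, norm_mul, norm_pow, pow_succ] at hcong
        exact le_of_mul_le_mul_left hcong (pow_pos hρ0 _)
      have h1 := nonvalue_natCast_mul p hϖ hb hnv hmp a ha
      exact absurd (key.trans_lt hϖ.1) (not_lt.mpr h1)

/-! ### §4a. No torsion witness ⇒ `r_in = A + 1` (R-W format) -/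

/-- **No torsion witness ⇒ the critical ball is NOT inside `log_p(𝒪_K^×)`** (`ζ_p ∈ K`).
[cite: SerreLocalFields1979, Ch. XIV §4] [cite: NeukirchANT1999, Ch. II (5.5)–(5.7)] -/
theorem not_closedBall_level_subset_logUnits_of_forall_not_torsionWitness (hp2 : p ≠ 2) {ζ : K}
    (hζ : ζ ^ p = 1) (hζ1 : ζ ≠ 1)
    (hno : ∀ ζ' u : K, (∃ n : ℕ, 0 < n ∧ ζ' ^ n = 1) → (∀ η : K, η ^ p ≠ ζ') →
      ‖(p : K)‖ * ‖(ϖ : K)‖ ^ A < ‖u ^ p - ζ'‖) :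
    ¬ closedBall (0 : K) (‖(ϖ : K)‖ ^ A) ⊆ logUnits K := fun h => by
  obtain ⟨ζ', u, hT, hnot, hu⟩ :=
    exists_torsionWitness_of_closedBall_level_subset_logUnits p hϖ hA hp2 hζ hζ1 h
  exact (not_lt.mpr hu) (hno ζ' u hT hnot)

/-- **`r_in = A + 1` when `ζ_p ∈ K` and there is no torsion witness** (`p` odd, `e = A(p−1)`, ANY `A`), in
the R-W format with `r = A + 1`: `closedBall 0 ‖ϖ‖^{A+1} ⊆ log_p(𝒪_K^×)` and
`¬ closedBall 0 ‖ϖ‖^A ⊆ log_p(𝒪_K^×)`.  E.g. `K = ℚ_p(ζ_{p²})` (`A = p`): `r_in = p + 1`.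
[cite: NeukirchANT1999, Ch. II Prop. (5.5)–(5.7)] [cite: SerreLocalFields1979, Ch. XIV §4] -/
theorem innerRadius_tie_succ_of_forall_not_torsionWitness (hp2 : p ≠ 2) {ζ : K} (hζ : ζ ^ p = 1)
    (hζ1 : ζ ≠ 1)
    (hno : ∀ ζ' u : K, (∃ n : ℕ, 0 < n ∧ ζ' ^ n = 1) → (∀ η : K, η ^ p ≠ ζ') →
      ‖(p : K)‖ * ‖(ϖ : K)‖ ^ A < ‖u ^ p - ζ'‖) :
    closedBall (0 : K) (‖(ϖ : K)‖ ^ (A + 1)) ⊆ logUnits K ∧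
      ¬ closedBall (0 : K) (‖(ϖ : K)‖ ^ A) ⊆ logUnits K := by
  refine ⟨?_, not_closedBall_level_subset_logUnits_of_forall_not_torsionWitness p hϖ hA hp2 hζ hζ1 hno⟩
  have h := closedBall_div_succ_subset_logUnits p hϖ (K := K)
  rwa [div_eq_level p hA] at h

end Field

end LogEnvelope

end Literature.IUT.LogVolume

end
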